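import Literature.Computability.AlgebraicComplexity.XyzCubeFlattening
import Literature.Computability.AlgebraicComplexity.BorderRankCWProofs
import HarnessLib

/-!
# The Levi-Civita tensor `E ≅ T_{skewcw,2}`, the `p = 3` Koszul flattening of its Kronecker cube in
# coordinates, and a block-certificate criterion for its rank

`Summits/MatrixMultiplication/MatrixMultiplication/Theorems` (soloist file, blind arm, session s27; the
infrastructure half of `SoloBlindSkewCubeKoszul941`, which certifies rank `≥ 941` and derives
`bR(T_{skewcw,2}^{⊠3}) ≥ 48`, `bR(T_{skewcw,2}^{⊠5}) ≥ 424`).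

Up to `GL₃ × GL₃ × GL₃` the skew Coppersmith–Winograd tensor `T = T_{skewcw,2}` (`skewCwTensor ℂ 1`) is the
Levi-Civita tensor `E = ∑_{σ ∈ 𝔖₃} sgn(σ) e_{σ0} ⊗ e_{σ1} ⊗ e_{σ2}` (CGLV §3.2; the tree's
`cglv_exists_basis_skewCwTensor_one`), here `lcTensor` with entries `leviCivita3Table`; hence
`bR(E^{⊠N}) ≤ bR(T^{⊠N})` (`algBorderRank_kroneckerPow_lc_le`).  `E` has the same support as the tree's
`xyz` tensor `X` of `XyzCubeFlattening.lean`, with signs, so that file's `p = 3` machinery (triple indices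
`Tri`, `comp3`, the wedge tables `wedgeJ7 / wedgeSgn7` and masks, the torus weight `xyzWt` and the block
keys `cubeRowKey / cubeColKey`, the container `CubeBlockCert`, `luCheck`) applies verbatim once the slice
value `X_j(b,c) = M_{j, comp3 b c}` is replaced by the signed `E_j(b,c) = ε³(b,c) · M_{j, comp3 b c}`,
`ε³(b,c) = ∏_i ε_{comp(b_i,c_i) b_i c_i}` (`phiValS`, `kfastS3`, `kfastSM`).  This file provides, for the
restriction `soloLcM : A^{⊗3} = ℤ^{27} → ℤ⁷` graded by `#₀ - #₂` with coefficients `1, 2`: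
the entry formula (`koszulFlattening_lcCube_apply`), the block structure
(`koszulFlattening_soloLcM_eq_zero_of_ne`), the block-certificate criterion
(`soloLc_le_rank_of_blockChecks`: distinct weights + every block accepted by `luCheck` ⇒ rank `≥ ∑ sizes`
over `ℂ`), and the bridge to `kroneckerPow (lcTensor ℂ) 3` (`koszulFlattening_kroneckerPow_three_lc_bridge`).

References: A. Conner, F. Gesmundo, J.M. Landsberg, E. Ventura, *Rank and border rank of Kronecker powers
of tensors and Strassen's laser method*, comput. complexity 31 (2022) = arXiv:1909.04785, §3.1 eq. (8),
§3.2; J.M. Landsberg, G. Ottaviani, Ann. Mat. Pura Appl. 192 (2013) (Koszul flattenings).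
-/

namespace Summit.MatrixMultiplication.MatrixMultiplication.Theorems

open Matrix
open Literature.Computability.AlgebraicComplexity

/-! ## The Levi-Civita tensor `E` and `T_{skewcw,2} ≥ E` -/

/-- **The Levi-Civita tensor** `E_{abc} = ε_{abc}` (`= a₀ ∧ a₁ ∧ a₂` as a trilinear form), the signed
companion of the tree's `xyzTensor`. [new] -/
def lcTensor (K : Type*) [CommRing K] : Fin 3 → Fin 3 → Fin 3 → K :=
  fun a b c => ((leviCivita3Table a b c : ℤ) : K)

/-- Entries of `E`. [new] -/
@[simp] theorem lcTensor_apply (K : Type*) [CommRing K] (a b c : Fin 3) :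
    lcTensor K a b c = ((leviCivita3Table a b c : ℤ) : K) := rfl

/-- **`T_{skewcw,2} ≥ E`** (in fact `≅`): CGLV §3.2's change of basis `(1, B, C)` takes `T_{skewcw,2}` to
`a₀ ∧ a₁ ∧ a₂` (the tree's `cglv_exists_basis_skewCwTensor_one`). [cite: ConnerGesmundoLandsbergVentura2022, §3.2] -/
theorem tensorRestrictsTo_skewCwTensor_lcTensor : TensorRestrictsTo (skewCwTensor ℂ 1) (lcTensor ℂ) := by
  obtain ⟨B, C, -, -, h⟩ := cglv_exists_basis_skewCwTensor_one
  refine ⟨(1 : Matrix (Fin 3) (Fin 3) ℂ), B, C, fun a b c => ?_⟩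
  rw [lcTensor_apply, ← leviCivita3_eq_table, ← h a b c]

/-- Hence `bR(E^{⊠N}) ≤ bR(T_{skewcw,2}^{⊠N})` for every `N`. [new] -/
theorem algBorderRank_kroneckerPow_lc_le (N : ℕ) :
    algBorderRank (kroneckerPow (lcTensor ℂ) N) ≤ algBorderRank (kroneckerPow (skewCwTensor ℂ 1) N) :=
  (tensorRestrictsTo_skewCwTensor_lcTensor.kroneckerPow N).algBorderRank_le

/-- The sign `ε_{comp(b,c) b c}` of a complementary pair (`0` on the diagonal). [new] -/
def lcSgn : Fin 3 → Fin 3 → ℤ := ![![0, 1, -1], ![-1, 0, 1], ![1, -1, 0]]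

/-- The Levi-Civita table through `comp1` and the pair sign. [new] -/
theorem leviCivita3Table_eq_ite : ∀ a b c : Fin 3,
    leviCivita3Table a b c = if comp1 b c = some a then lcSgn b c else 0 := by
  decide

/-- Entries of `E` through `comp1`: `E_{abc} = [comp1 b c = a] · ε(b,c)`. [new] -/
theorem lcTensor_eq_ite (K : Type*) [CommRing K] (a b c : Fin 3) :
    lcTensor K a b c = if comp1 b c = some a then (lcSgn b c : K) else 0 := by
  rw [lcTensor_apply, leviCivita3Table_eq_ite]
  split_ifs <;> simp

/-! ## The Kronecker cube `E^{⊠3}` on triple indices -/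

/-- `E^{⊠3}` on triple indices: entry `E_{a₁b₁c₁} E_{a₂b₂c₂} E_{a₃b₃c₃}`. [new] -/
def lcCube (K : Type*) [CommRing K] : Tri → Tri → Tri → K :=
  fun a b c => lcTensor K a.1 b.1 c.1 * lcTensor K a.2.1 b.2.1 c.2.1 * lcTensor K a.2.2 b.2.2 c.2.2

/-- Entries of `lcCube`. [new] -/
@[simp] theorem lcCube_apply (K : Type*) [CommRing K] (a b c : Tri) :
    lcCube K a b c = lcTensor K a.1 b.1 c.1 * lcTensor K a.2.1 b.2.1 c.2.1 * lcTensor K a.2.2 b.2.2 c.2.2 :=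
  rfl

/-- `kroneckerPow E 3` is `lcCube` relabelled along `(Fin 3 → Fin 3) ≃ Tri`. [new] -/
theorem kroneckerPow_three_lc_eq (K : Type*) [CommRing K] :
    kroneckerPow (lcTensor K) 3 = fun a b c =>
      lcCube K (arrowFinThreeEquiv _ a) (arrowFinThreeEquiv _ b) (arrowFinThreeEquiv _ c) := by
  funext a b c
  simp [kroneckerPow_apply, Fin.prod_univ_three, arrowFinThreeEquiv]

/-- The sign `ε³(b,c) = ∏_i ε(b_i, c_i)` of a pair of triples. [new] -/
def lcSgn3 (b c : Tri) : ℤ := lcSgn b.1 c.1 * lcSgn b.2.1 c.2.1 * lcSgn b.2.2 c.2.2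

/-- `(E^{⊠3})_{abc} = [comp3 b c = a] · ε³(b,c)`. [new] -/
theorem lcCube_eq_ite (K : Type*) [CommRing K] (a b c : Tri) :
    lcCube K a b c = if comp3 b c = some a then (lcSgn3 b c : K) else 0 := by
  rw [lcCube_apply, lcTensor_eq_ite, lcTensor_eq_ite, lcTensor_eq_ite]
  by_cases h1 : comp1 b.1 c.1 = some a.1 <;> by_cases h2 : comp1 b.2.1 c.2.1 = some a.2.1 <;>
    by_cases h3 : comp1 b.2.2 c.2.2 = some a.2.2 <;> simp [h1, h2, h3, comp3_eq_some_iff, lcSgn3]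

/-- The integer cube casts to the cube over any commutative ring. [new] -/
theorem lcCube_intCast (R : Type*) [CommRing R] (a b c : Tri) :
    ((lcCube ℤ a b c : ℤ) : R) = lcCube R a b c := by
  rw [lcCube_eq_ite, lcCube_eq_ite]
  split_ifs <;> simp

/-! ## Slices of the restricted cube and the entries of its Koszul flattenings -/

section Entries

variable {R : Type*} [CommRing R] {m : ℕ}

/-- The signed slice entry `E_j(b, c) = ε³(b,c) · M_{j, comp3 b c}` of `(M ⊗ 1 ⊗ 1) E^{⊠3}` (zero if
undefined). [new] -/
def phiValS (M : Matrix (Fin m) Tri R) (j : Fin m) (b c : Tri) : R :=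
  match comp3 b c with
  | some x => M j x * (lcSgn3 b c : R)
  | none => 0

/-- **Slice formula**: `∑_a M_{ja} (E^{⊠3})_{abc} = E_j(b, c)`. [new] -/
theorem sum_mul_lcCube (M : Matrix (Fin m) Tri R) (j : Fin m) (b c : Tri) :
    ∑ a, M j a * lcCube R a b c = phiValS M j b c := by
  unfold phiValS
  simp only [lcCube_eq_ite]
  rcases h : comp3 b c with _ | x
  · simp
  · simp only [Option.some.injEq]
    rw [Finset.sum_eq_single x]
    · simp
    · intro a _ ha
      simp [Ne.symm ha]
    · simp

/-- **Entry formula** for the Koszul flattening of `(M ⊗ 1 ⊗ 1) E^{⊠3}` (any `p`; row `(T, c)`, column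
`(S, b)`): `K = ∑_j [j ∉ S, T = S ∪ j] ε(S,j) · E_j(b, c)`. [cite: ConnerGesmundoLandsbergVentura2022, §3.1 eq. (8)] -/
theorem koszulFlattening_lcCube_apply (p : ℕ) (M : Matrix (Fin (2 * p + 1)) Tri R)
    (r : PSub (2 * p + 1) (p + 1) × Tri) (c : PSub (2 * p + 1) p × Tri) :
    koszulFlattening p M.mulVecLin (lcCube R) r c =
      ∑ j, (if j ∉ c.1.1 ∧ r.1.1 = insert j c.1.1 then (koszulSign c.1.1 j : R) else 0) *
        phiValS M j c.2 r.2 := by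
  rw [koszulFlattening_apply, wedgeMatrix_apply]
  refine Finset.sum_congr rfl fun j _ => ?_
  split_ifs
  · rw [Matrix.mulVecLin_apply, Matrix.mulVec, dotProduct, sum_mul_lcCube]
  · rw [zero_mul]

/-- Base change `ℤ → R` of the Koszul flattening of the cube. [new] -/
theorem koszulFlattening_lcCube_intCast (p : ℕ) (M : Matrix (Fin (2 * p + 1)) Tri ℤ) :
    koszulFlattening p (M.map (Int.castRingHom R)).mulVecLin (lcCube R) =
      (koszulFlattening p M.mulVecLin (lcCube ℤ)).map (Int.castRingHom R) := by
  rw [koszulFlattening_map]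
  congr 1
  funext a b c
  exact (lcCube_intCast R a b c).symm

end Entries

/-! ## `p = 3` in coordinates: fast entries (the tree's wedge tables and masks, signed slices) -/

/-- Fast entry function of the `p = 3` Koszul flattening of `(M ⊗ 1 ⊗ 1) E^{⊠3}` over `ℤ`, row
`(dec4of7 ti, c)`, column `(dec3of7 si, b)`, table form. [new] -/
def kfastS3 (M : Matrix (Fin 7) Tri ℤ) (ti : Fin 35) (c : Tri) (si : Fin 35) (b : Tri) : ℤ :=
  if h : wedgeJ7 ti si < 7 then wedgeSgn7 ti si * phiValS M ⟨wedgeJ7 ti si, h⟩ b c else 0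

/-- `kfastS3` computes the entries of the Koszul flattening. [new] -/
theorem kfastS3_eq (M : Matrix (Fin 7) Tri ℤ) (ti : Fin 35) (c : Tri) (si : Fin 35) (b : Tri) :
    kfastS3 M ti c si b = koszulFlattening 3 M.mulVecLin (lcCube ℤ) (dec4of7 ti, c) (dec3of7 si, b) := by
  rw [koszulFlattening_lcCube_apply]
  simp only [Int.cast_id, ← incTab3_eq ti si]
  unfold kfastS3 incTab3
  by_cases h : wedgeJ7 ti si < 7
  · rw [dif_pos h, Finset.sum_eq_single ⟨wedgeJ7 ti si, h⟩]
    · simp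
    · intro j _ hj
      rw [if_neg, zero_mul]
      intro hh
      exact hj (Fin.ext hh.symm)
    · simp
  · rw [dif_neg h]
    symm
    refine Finset.sum_eq_zero fun j _ => ?_
    rw [if_neg, zero_mul]
    intro hh
    exact h (hh ▸ j.isLt)

/-- **Fast entry function, mask form** (what the kernel evaluates on the certificate). [new] -/
def kfastSM (M : Matrix (Fin 7) Tri ℤ) (ti : Fin 35) (c : Tri) (si : Fin 35) (b : Tri) : ℤ :=
  if h : (wedgeOfMasks (mask4fast ti.val) (mask3fast si.val)).1 < 7 then
    (wedgeOfMasks (mask4fast ti.val) (mask3fast si.val)).2 *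
      phiValS M ⟨(wedgeOfMasks (mask4fast ti.val) (mask3fast si.val)).1, h⟩ b c
  else 0

/-- `kfastSM = kfastS3`. [new] -/
theorem kfastSM_eq_kfastS3 (M : Matrix (Fin 7) Tri ℤ) (ti : Fin 35) (c : Tri) (si : Fin 35) (b : Tri) :
    kfastSM M ti c si b = kfastS3 M ti c si b := by
  unfold kfastSM kfastS3
  rw [wedgeOfMasks_eq]

/-- `kfastSM` computes the entries of the Koszul flattening. [new] -/
theorem kfastSM_eq (M : Matrix (Fin 7) Tri ℤ) (ti : Fin 35) (c : Tri) (si : Fin 35) (b : Tri) :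
    kfastSM M ti c si b = koszulFlattening 3 M.mulVecLin (lcCube ℤ) (dec4of7 ti, c) (dec3of7 si, b) := by
  rw [kfastSM_eq_kfastS3, kfastS3_eq]

/-! ## The graded restriction with coefficients `1, 2` and the block structure -/

/-- Coefficient of the word `x = (a, b, c)`: `2` on the eight words with `9a + 3b + c ∈ [2, 5, 8, 10, 17, 18, 19, 23]`, else `1`
(a random `{1,2}`-pattern at which the graded `p = 3` flattening attains its maximal rank `941`). [new] -/
def soloLcCoef (x : Tri) : ℤ :=
  if 9 * x.1.val + 3 * x.2.1.val + x.2.2.val ∈ ([2, 5, 8, 10, 17, 18, 19, 23] : List ℕ) then 2 else 1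

/-- **The restriction `A^{⊗3} → ℤ⁷`**: `e_x ↦ soloLcCoef x · e_{xyzWt x + 3}` (the tree's seven torus-weight
classes `#₀(x) - #₂(x) = e - 3`, generic coefficients inside each class). [new] -/
def soloLcM : Matrix (Fin 7) Tri ℤ :=
  Matrix.of fun e x => if xyzWt x + 3 = (e : ℤ) then soloLcCoef x else 0

/-- A non-zero signed slice value of the `soloLcM`-restricted cube sits at a complementary triple of the
right weight. [new] -/
theorem phiValS_soloLcM_ne_zero {j : Fin 7} {b c : Tri} (h : phiValS soloLcM j b c ≠ 0) :
    ∃ x, comp3 b c = some x ∧ xyzWt x + 3 = (j : ℤ) := by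
  unfold phiValS at h
  rcases hc : comp3 b c with _ | x
  · simp [hc] at h
  · refine ⟨x, rfl, ?_⟩
    simp only [hc, soloLcM, Matrix.of_apply] at h
    by_contra hne
    exact h (by rw [if_neg hne, zero_mul])

/-- **Block structure**: the `p = 3` Koszul flattening of the `soloLcM`-restricted cube is graded — an entry
between a row and a column of different weights vanishes (`E^{⊠3}` has torus weight `0`). [new] -/
theorem koszulFlattening_soloLcM_eq_zero_of_ne (r : PSub 7 4 × Tri) (c : PSub 7 3 × Tri)
    (h : cubeRowKey r ≠ cubeColKey c) : koszulFlattening 3 soloLcM.mulVecLin (lcCube ℤ) r c = 0 := by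
  rw [koszulFlattening_lcCube_apply]
  refine Finset.sum_eq_zero fun j _ => ?_
  split_ifs with hj
  · obtain ⟨hjR, hS⟩ := hj
    by_contra hne
    have hphi : phiValS soloLcM j c.2 r.2 ≠ 0 := fun h0 => hne (by rw [h0, mul_zero])
    obtain ⟨x, hx, hgx⟩ := phiValS_soloLcM_ne_zero hphi
    have hsum := xyzWt_add_of_comp3 hx
    have hk : cubeKeySub r.1.1 = cubeKeySub c.1.1 + ((j : ℤ) - 3) := by
      unfold cubeKeySub
      rw [hS, Finset.sum_insert hjR]
      ring
    apply h
    unfold cubeRowKey cubeColKey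
    omega
  · exact zero_mul _

/-! ## Block certificates (the tree's `CubeBlockCert` container, entries from `kfastSM soloLcM`) -/

/-- The entries of a block minor of the `soloLcM`-restricted flattening, computed by `kfastSM`. [new] -/
def soloLcEntry (bc : CubeBlockCert) (i j : Fin bc.k) : ℤ :=
  kfastSM soloLcM (bc.rowLab i.val).1 (bc.rowLab i.val).2 (bc.colLab j.val).1 (bc.colLab j.val).2

/-- The checks of one block: all its labels have weight `key`, and `luCheck` accepts the factors against
the `soloLcM` entries. [new] -/
def soloLcCheck (pr : ℕ) (bc : CubeBlockCert) : Bool :=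
  (List.range bc.k).all (fun i =>
      decide (cubeRowKey (bc.row i) = bc.key) && decide (cubeColKey (bc.col i) = bc.key)) &&
    luCheck bc.k pr (soloLcEntry bc) (fun i => chunkGet bc.lower i.val []) (fun i => chunkGet bc.upper i.val [])

/-- Soundness of one block: a non-zero minor over `ℤ` on the block's rows and columns, all of weight
`key`. [new] -/
theorem soloLcCheck_sound {pr : ℕ} [Fact pr.Prime] {bc : CubeBlockCert} (h : soloLcCheck pr bc = true) :
    (∀ i, i < bc.k → cubeRowKey (bc.row i) = bc.key ∧ cubeColKey (bc.col i) = bc.key) ∧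
      ((koszulFlattening 3 soloLcM.mulVecLin (lcCube ℤ)).submatrix
        (fun i : Fin bc.k => bc.row i.val) (fun j : Fin bc.k => bc.col j.val)).det ≠ 0 := by
  unfold soloLcCheck at h
  simp only [Bool.and_eq_true, List.all_eq_true, List.mem_range, decide_eq_true_eq] at h
  refine ⟨fun i hi => h.1 i hi, ?_⟩
  have hdet := det_ne_zero_of_luCheck h.2
  have hsub : (Matrix.of fun i j : Fin bc.k => soloLcEntry bc i j) =
      (koszulFlattening 3 soloLcM.mulVecLin (lcCube ℤ)).submatrix
        (fun i : Fin bc.k => bc.row i.val) (fun j : Fin bc.k => bc.col j.val) := by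
    ext i j
    exact kfastSM_eq _ _ _ _ _
  rwa [hsub] at hdet

/-- **Block certificate criterion** for the `soloLcM`-restricted flattening: pairwise distinct block weights
and every block accepted give rank `≥ ∑ (block sizes)` over `ℂ`. [new] -/
theorem soloLc_le_rank_of_blockChecks (pr : ℕ) [Fact pr.Prime] (bs : List CubeBlockCert)
    (hnd : (bs.map CubeBlockCert.key).Nodup) (hall : ∀ bc ∈ bs, soloLcCheck pr bc = true) :
    ∑ w : Fin bs.length, (bs.get w).k ≤
      ((koszulFlattening 3 soloLcM.mulVecLin (lcCube ℤ)).map (Int.castRingHom ℂ)).rank := by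
  have hblk : ∀ w : Fin bs.length, soloLcCheck pr (bs.get w) = true := fun w => hall _ (List.get_mem bs w)
  have hkey : ∀ w w' : Fin bs.length, (bs.get w).key = (bs.get w').key → w = w' := by
    intro w w' he
    have hinj := List.nodup_iff_injective_get.1 hnd
    have hw : (bs.map CubeBlockCert.key).get ⟨w.val, by simp⟩ = (bs.get w).key := by simp
    have hw' : (bs.map CubeBlockCert.key).get ⟨w'.val, by simp⟩ = (bs.get w').key := by simp
    have := hinj (hw.trans (he.trans hw'.symm))
    exact Fin.ext (by simpa using this)
  refine sum_le_rank_of_det_blocks_ne_zero (fun w => (bs.get w).k)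
    ((koszulFlattening 3 soloLcM.mulVecLin (lcCube ℤ)).map (Int.castRingHom ℂ))
    (fun (w : Fin bs.length) (i : Fin (bs.get w).k) => (bs.get w).row i.val)
    (fun (w : Fin bs.length) (j : Fin (bs.get w).k) => (bs.get w).col j.val)
    (fun w w' i j hw => ?_) (fun w => ?_)
  · rw [Matrix.map_apply, koszulFlattening_soloLcM_eq_zero_of_ne, map_zero]
    rw [((soloLcCheck_sound (hblk w)).1 i.val i.isLt).1,
      ((soloLcCheck_sound (hblk w')).1 j.val j.isLt).2]
    exact fun he => hw (hkey w w' he)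
  · have hdet := (soloLcCheck_sound (hblk w)).2
    rw [show ((koszulFlattening 3 soloLcM.mulVecLin (lcCube ℤ)).map (Int.castRingHom ℂ)).submatrix
        (fun i : Fin (bs.get w).k => (bs.get w).row i.val)
        (fun j : Fin (bs.get w).k => (bs.get w).col j.val) =
      (Int.castRingHom ℂ).mapMatrix ((koszulFlattening 3 soloLcM.mulVecLin (lcCube ℤ)).submatrix
        (fun i : Fin (bs.get w).k => (bs.get w).row i.val)
        (fun j : Fin (bs.get w).k => (bs.get w).col j.val)) from rfl,
      ← RingHom.map_det, Ne, eq_intCast, Int.cast_eq_zero]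
    exact hdet

/-! ## The bridge to `kroneckerPow (lcTensor ℂ) 3` -/

/-- The restriction `soloLcM` read on arrow indices `Fin 3 → Fin 3`, over `ℂ`. [new] -/
noncomputable def soloLcMArrow : Matrix (Fin 7) (Fin 3 → Fin 3) ℂ :=
  Matrix.of fun e a => ((soloLcM e (arrowFinThreeEquiv _ a) : ℤ) : ℂ)

/-- **The bridge**: the `p = 3` flattening of `kroneckerPow E 3` after `soloLcMArrow` is, up to relabelling
rows and columns along `(Fin 3 → Fin 3) ≃ Tri`, the base change to `ℂ` of the integer flattening of the
`soloLcM`-restricted cube. [new] -/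
theorem koszulFlattening_kroneckerPow_three_lc_bridge :
    koszulFlattening 3 soloLcMArrow.mulVecLin (kroneckerPow (lcTensor ℂ) 3) =
      ((koszulFlattening 3 soloLcM.mulVecLin (lcCube ℤ)).map (Int.castRingHom ℂ)).submatrix
        (Equiv.prodCongr (Equiv.refl _) (arrowFinThreeEquiv (Fin 3)))
        (Equiv.prodCongr (Equiv.refl _) (arrowFinThreeEquiv (Fin 3))) := by
  rw [← koszulFlattening_lcCube_intCast, kroneckerPow_three_lc_eq]
  refine koszulFlattening_comp_submatrix 3 _ _ (lcCube ℂ) _ _ _ fun v => ?_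
  funext j
  simp only [Matrix.mulVecLin_apply, Matrix.mulVec, dotProduct]
  exact Fintype.sum_equiv (arrowFinThreeEquiv (Fin 3)) _ _ fun a => by
    simp [soloLcMArrow, Matrix.map_apply]

end Summit.MatrixMultiplication.MatrixMultiplication.Theorems
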